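import Summits.ResolutionOfSingularities.ResolutionOfSingularities.Theorems.PurelyInseparableDim4WinCertSubstSound
import HarnessLib
import HarnessLib.Audit.Tags

/-!
# Purely inseparable fourfolds — FCert v3 («LCert»): KIND-AGNOSTIC LEAVES given by closed and open conditions, cover
# witnesses with arbitrary polynomial factors and vanishing side conditions, and THE COVER
# [OURS · counted 0 · a certificate format for OUR frame v4, not about resolution]

Census cell «res-dim4-pi» (D-0157 DOOR 2), desk WORDS #111 (b) / #113 (d); seat res-rescue-typ-3 g9.  Sequel of this seat's
`…WinCertSubst` / `…WinCertSubstSound` (FCert v2: flats + SUBSTITUTION leaves).  The ∀K residue measured there (kit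
j321678 / j321752) needs MORE leaf kinds — res-dim4-p-8 g3's NORM leaves (`…ScopeBlindNormLeaf`: 𝔽₄-conjugate plane pairs),
the announced LAURENT leaves (rational graphs `a·x_m = c`), constants — each with its own Boolean certificate and soundness
theorem.  Rather than one row checker per kind, THIS FILE makes the leaf notion IMPLICIT and the checker PARAMETRIC:

* `ILeaf k C` — chart `j`, CLOSED conditions `gens : List (Terms 4 k)` (`h(b) = 0`), OPEN conditions `opens` (`a(b) ≠ 0`),
  and a kind-specific certificate `cert : C`; `OnLeaf f ℓ b` := all `gens` vanish and all `opens` do not, at `b` read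
  through `f`.  A point OFF the leaf satisfies an ALTERNATIVE (`LAlt`): some `h(b) ≠ 0` or some `a(b) = 0`
  (`exists_alt_of_not_onLeaf`).
* `LWit` — cover witness `Σ_α g_α·D^{(α)}G + h·x_j + Σ_z c_z·z = ((x_i^p − x_i)·Π (x_t − c)·Π_r h_r)^N` with polynomial
  FACTORS `h_r` (one per leaf alternative of type `fac`) and VANISHING side conditions `z` (leaf alternatives of type `vz`);
  `lwitB`, `pow_eq_zero_of_lwitB`.
* `lcoverOKL p q s S j wits flats leaves` — for every `i ≠ j`, every choice of one fixed coordinate per flat and one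
  alternative per leaf of the chart, a matching witness (`lwitForB`); **`rational_or_onFlat_or_onILeaf`**: every
  equimultiple `K`-point of the chart is `𝔽_p`-rational, on a flat, or on a leaf.
The row checker `lwinCertBL p q leafOK` — parametrised by a LEAF ORACLE `leafOK` with a soundness hypothesis
`LeafSound` — and its ∀K soundness are the sequel `…WinCertLeafSound`; the oracles for the landed kinds (substitution,
norm) are `…WinCertLeafKinds`.  Nothing here proves resolution of singularities in dimension ≥ 4 / characteristic `p`;
F4-C(2,2) stays OPEN; counted 0; AI work, weaker than expert review.
bears_on: LADDER-RESOLUTION:D157-DOOR2 (res-dim4-pi · F4-C ∀K column · FCert v3). Supports stmt-ResolutionOfSingularities-16155 (helper).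
-/

set_option linter.dupNamespace false

noncomputable section
open MvPolynomial Finset
open scoped BigOperators
namespace Summit.ResolutionOfSingularities.ResolutionOfSingularities.Theorems.PIDim4

namespace WinCertLeaf

open Literature.AlgebraicGeometry.Resolution
open Literature.AlgebraicGeometry.Resolution.CentreBlowup
open StepKit WinCertSound InScopeWinCert ScopeCover ScopeBlind WinCertAllFields WinCertFlat WinCertSubst

variable {k : Type} [Field k] [DecidableEq k]

/-! ## 1. Cover witnesses with polynomial factors and vanishing side conditions -/

/-- A **cover witness** of FCert v3: chart `j`, coordinate `i`, exponent `N`, linear factors `(t, c)` (`x_t − c`, one per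
flat), polynomial FACTORS `facs`, vanishing side conditions with cofactors `zs = [(z, c_z), …]`, Hasse cofactors `gs` and
the cofactor `h` of `x_j`; it claims `Σ_α g_α·D^{(α)}G + h·x_j + Σ c_z·z = ((x_i^p − x_i)·Π (x_t − c)·Π facs)^N`.
[folklore] -/
structure LWit (k : Type) where
  /-- the chart variable -/
  j : Fin 4
  /-- the coordinate forced rational off the flats and leaves -/
  i : Fin 4
  /-- the exponent `N` -/
  N : ℕ
  /-- the linear factors `x_t − c`, one per flat of the chart -/
  lin : List (Fin 4 × k)
  /-- the polynomial factors, one per leaf alternative of type `fac` -/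
  facs : List (Terms 4 k)
  /-- vanishing side conditions `z` with their cofactors `c_z` -/
  zs : List (Terms 4 k × Terms 4 k)
  /-- cofactors of the Hasse derivatives, as (multi-index, term list) -/
  gs : List ((Fin 4 → ℕ) × Terms 4 k)
  /-- cofactor of `x_j` -/
  h : Terms 4 k

/-- The term list of `Π facs`. [folklore] -/
def facProdL : List (Terms 4 k) → Terms 4 k
  | [] => [(fun _ => 0, 1)]
  | P :: rest => mulL P (facProdL rest)

/-- The term list of `Σ c_z · z`. [folklore] -/
def zsSumL : List (Terms 4 k × Terms 4 k) → Terms 4 k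
  | [] => []
  | zc :: rest => mulL zc.2 zc.1 ++ zsSumL rest

/-- **Checking a cover witness** on the chart transform `G` (term list). [folklore] -/
def lwitB (p q : ℕ) (G : Terms 4 k) (w : LWit k) : Bool :=
  (w.gs.all fun ag => decide (0 < ∑ l, ag.1 l ∧ ∑ l, ag.1 l < q)) &&
    StepKit.equivB (normL (witLHS G ⟨w.j, w.i, w.N, w.gs, w.h⟩ ++ zsSumL w.zs))
      (normL (powL (mulL (mulL (xPowSubX p w.i) (linProdL w.lin)) (facProdL w.facs)) w.N))

omit [DecidableEq k] in
/-- `eval₂Hom f b (Π facs) = Π eval₂Hom f b fac`. [folklore] -/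
theorem eval₂Hom_facProdL {K : Type} [Field K] (f : k →+* K) (b : Fin 4 → K) :
    ∀ facs : List (Terms 4 k), eval₂Hom f b (evalT (facProdL facs)) = (facs.map fun P => eval₂Hom f b (evalT P)).prod
  | [] => by
    simp only [facProdL, evalT_cons, evalT_nil, add_zero, eval₂Hom_monomial_expo, pow_zero,
      Finset.prod_const_one, mul_one, map_one, List.map_nil, List.prod_nil]
  | P :: rest => by
    rw [facProdL, evalT_mulL, map_mul, eval₂Hom_facProdL f b rest, List.map_cons, List.prod_cons]

omit [DecidableEq k] in
/-- `eval₂Hom f b (Σ c_z·z) = 0` when every `z` vanishes at `b`. [folklore] -/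
theorem eval₂Hom_zsSumL_eq_zero {K : Type} [Field K] (f : k →+* K) (b : Fin 4 → K) :
    ∀ zs : List (Terms 4 k × Terms 4 k), (∀ zc ∈ zs, eval₂Hom f b (evalT zc.1) = 0) →
      eval₂Hom f b (evalT (zsSumL zs)) = 0
  | [], _ => by simp [zsSumL]
  | zc :: rest, hz => by
    rw [zsSumL, evalT_append, map_add, evalT_mulL, map_mul, hz zc List.mem_cons_self, mul_zero, zero_add]
    exact eval₂Hom_zsSumL_eq_zero f b rest fun zc' h' => hz zc' (List.mem_cons_of_mem _ h')

/-- **Soundness of a cover witness**: at a `K`-point `b` with `b_j = 0` where every Hasse derivative `D^{(α)}G`,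
`0 < |α| < q`, vanishes and every side condition `z` vanishes, `((b_i^p − b_i)·Π (b_t − f c)·Π fac(b))^N = 0`.
[folklore] -/
theorem pow_eq_zero_of_lwitB {p q : ℕ} {G : Terms 4 k} {w : LWit k} (hw : lwitB p q G w = true)
    {K : Type} [Field K] (f : k →+* K) (b : Fin 4 → K) (hbj : b w.j = 0)
    (hzero : ∀ α : Fin 4 → ℕ, 0 < ∑ l, α l → ∑ l, α l < q →
      eval₂Hom f b (hasseDeriv (expo α) (evalT G)) = 0)
    (hzs : ∀ zc ∈ w.zs, eval₂Hom f b (evalT zc.1) = 0) :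
    ((b w.i ^ p - b w.i) * (w.lin.map fun tc => b tc.1 - f tc.2).prod *
        (w.facs.map fun P => eval₂Hom f b (evalT P)).prod) ^ w.N = 0 := by
  unfold lwitB at hw
  rw [Bool.and_eq_true, List.all_eq_true] at hw
  obtain ⟨hdeg, hequiv⟩ := hw
  have hid : evalT (witLHS G ⟨w.j, w.i, w.N, w.gs, w.h⟩ ++ zsSumL w.zs) =
      evalT (powL (mulL (mulL (xPowSubX p w.i) (linProdL w.lin)) (facProdL w.facs)) w.N) := by
    rw [← evalT_normL (witLHS G _ ++ _), ← evalT_normL (powL _ _)]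
    exact (evalT_eq_iff_equivB _ _).mpr hequiv
  have hl : eval₂Hom f b (evalT (witLHS G ⟨w.j, w.i, w.N, w.gs, w.h⟩ ++ zsSumL w.zs)) = 0 := by
    rw [evalT_append, map_add, eval₂Hom_zsSumL_eq_zero f b w.zs hzs, add_zero, witLHS, evalT_append, map_add,
      evalT_mulL, map_mul]
    rw [eval₂Hom_sumHasseL_eq_zero f b G w.gs fun ag hag => ?_]
    · simp only [evalT_cons, evalT_nil, add_zero, eval₂Hom_monomial_expo, prod_pow_unitE, pow_one, hbj,
        map_one, mul_zero]
    · have hd := of_decide_eq_true (hdeg ag hag)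
      exact hzero ag.1 hd.1 hd.2
  have hr : eval₂Hom f b (evalT (powL (mulL (mulL (xPowSubX p w.i) (linProdL w.lin)) (facProdL w.facs)) w.N)) =
      ((b w.i ^ p - b w.i) * (w.lin.map fun tc => b tc.1 - f tc.2).prod *
        (w.facs.map fun P => eval₂Hom f b (evalT P)).prod) ^ w.N := by
    rw [evalT_powL, map_pow, evalT_mulL, map_mul, evalT_mulL, map_mul, eval₂Hom_xPowSubX, eval₂Hom_linProdL,
      eval₂Hom_facProdL]
  rw [← hr, ← hid, hl]

/-! ## 2. Implicit leaves -/

/-- An **implicit leaf** of chart `j`: CLOSED conditions `gens` (`h(b) = 0`), OPEN conditions `opens` (`a(b) ≠ 0`), and a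
kind-specific blindness certificate `cert : C` (checked by a leaf oracle, see `…WinCertLeafSound`). [folklore] -/
structure ILeaf (k : Type) (C : Type) where
  /-- the chart variable -/
  j : Fin 4
  /-- closed conditions: these polynomials vanish on the leaf -/
  gens : List (Terms 4 k)
  /-- open conditions: these polynomials do not vanish on the leaf -/
  opens : List (Terms 4 k)
  /-- the blindness certificate of the leaf -/
  cert : C

/-- `b` lies on the leaf `ℓ` (read in `K` through `f`). [folklore] -/
def OnLeaf {C : Type} {K : Type} [Field K] (f : k →+* K) (ℓ : ILeaf k C) (b : Fin 4 → K) : Prop :=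
  (∀ h ∈ ℓ.gens, eval₂Hom f b (evalT h) = 0) ∧ ∀ a ∈ ℓ.opens, eval₂Hom f b (evalT a) ≠ 0

/-- Kernel-reducible on-leaf test for a `k`-rational point (`ScopeBlind.evalAtL`). [folklore] -/
def onLeafBL {C : Type} (ℓ : ILeaf k C) (b : Fin 4 → k) : Bool :=
  decide (∀ h ∈ ℓ.gens, evalAtL b h = 0) && decide (∀ a ∈ ℓ.opens, evalAtL b a ≠ 0)

/-- An **alternative** witnessing that a point is OFF a leaf: a closed condition failing (`fac h`: `h(b) ≠ 0`) or an
open condition failing (`vz a`: `a(b) = 0`). [folklore] -/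
inductive LAlt (k : Type) where
  /-- `h(b) ≠ 0` -/
  | fac (h : Terms 4 k) : LAlt k
  /-- `a(b) = 0` -/
  | vz (a : Terms 4 k) : LAlt k
deriving DecidableEq

/-- The alternatives of a leaf. [folklore] -/
def alts {C : Type} (ℓ : ILeaf k C) : List (LAlt k) := ℓ.gens.map LAlt.fac ++ ℓ.opens.map LAlt.vz

/-- The alternative holds at `b`. [folklore] -/
def AltHolds {K : Type} [Field K] (f : k →+* K) (b : Fin 4 → K) : LAlt k → Prop
  | .fac h => eval₂Hom f b (evalT h) ≠ 0
  | .vz a => eval₂Hom f b (evalT a) = 0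

/-- The factor list of a choice of alternatives (the `fac` entries, in order). [folklore] -/
def facsOf : List (LAlt k) → List (Terms 4 k)
  | [] => []
  | .fac h :: rest => h :: facsOf rest
  | .vz _ :: rest => facsOf rest

/-- The vanishing list of a choice of alternatives (the `vz` entries, in order). [folklore] -/
def vzsOf : List (LAlt k) → List (Terms 4 k)
  | [] => []
  | .fac _ :: rest => vzsOf rest
  | .vz a :: rest => a :: vzsOf rest

omit [DecidableEq k] in
/-- **A point off the leaf satisfies one of its alternatives.** [folklore] -/
theorem exists_alt_of_not_onLeaf {C : Type} {K : Type} [Field K] (f : k →+* K) (ℓ : ILeaf k C) {b : Fin 4 → K}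
    (hnot : ¬ OnLeaf f ℓ b) : ∃ t ∈ alts ℓ, AltHolds f b t := by
  classical
  unfold OnLeaf at hnot
  rw [not_and_or] at hnot
  rcases hnot with h | h
  · push Not at h
    obtain ⟨g, hg, hne⟩ := h
    exact ⟨.fac g, List.mem_append_left _ (List.mem_map.mpr ⟨g, hg, rfl⟩), hne⟩
  · push Not at h
    obtain ⟨a, ha, hz⟩ := h
    exact ⟨.vz a, List.mem_append_right _ (List.mem_map.mpr ⟨a, ha, rfl⟩), hz⟩

omit [DecidableEq k] in
/-- Along a choice of alternatives that all hold at `b`: the factors do not vanish at `b`, the `vz` entries do.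
[folklore] -/
theorem facsOf_prod_ne_zero {K : Type} [Field K] (f : k →+* K) (b : Fin 4 → K) :
    ∀ ρ : List (LAlt k), (∀ t ∈ ρ, AltHolds f b t) →
      ((facsOf ρ).map fun P => eval₂Hom f b (evalT P)).prod ≠ 0 ∧ ∀ a ∈ vzsOf ρ, eval₂Hom f b (evalT a) = 0
  | [], _ => ⟨by simp [facsOf], by simp [vzsOf]⟩
  | .fac h :: rest, hρ => by
    obtain ⟨h1, h2⟩ := facsOf_prod_ne_zero f b rest fun t ht => hρ t (List.mem_cons_of_mem _ ht)
    refine ⟨?_, fun a ha => h2 a (by simpa [vzsOf] using ha)⟩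
    rw [facsOf, List.map_cons, List.prod_cons]
    exact mul_ne_zero (hρ _ List.mem_cons_self) h1
  | .vz a :: rest, hρ => by
    obtain ⟨h1, h2⟩ := facsOf_prod_ne_zero f b rest fun t ht => hρ t (List.mem_cons_of_mem _ ht)
    refine ⟨by rw [facsOf]; exact h1, fun a' ha' => ?_⟩
    rw [vzsOf, List.mem_cons] at ha'
    rcases ha' with rfl | ha'
    · exact hρ _ List.mem_cons_self
    · exact h2 a' ha'

/-- A `k`-rational point passing `onLeafBL` is on the leaf over `K`. [folklore] -/
theorem onLeaf_of_onLeafBL {C : Type} {K : Type} [Field K] (f : k →+* K) {ℓ : ILeaf k C} {b₀ : Fin 4 → k}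
    (h : onLeafBL ℓ b₀ = true) : OnLeaf f ℓ (f ∘ b₀) := by
  classical
  unfold onLeafBL at h
  rw [Bool.and_eq_true, decide_eq_true_eq, decide_eq_true_eq] at h
  have hcomp : ∀ L : Terms 4 k, eval₂Hom f (f ∘ b₀) (evalT L) = f (evalAtL b₀ L) := by
    intro L
    rw [← eval_evalT, show eval₂Hom f (f ∘ b₀) = f.comp (MvPolynomial.eval b₀) from ?_]
    · rfl
    · refine MvPolynomial.ringHom_ext (fun c => ?_) (fun n => ?_)
      · simp
      · simp
  refine ⟨fun g hg => ?_, fun a ha => ?_⟩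
  · rw [hcomp, h.1 g hg, map_zero]
  · rw [hcomp, map_ne_zero_iff f f.injective]
    exact h.2 a ha

/-! ## 3. The cover check and THE COVER -/

/-- **A witness with prescribed chart, coordinate, linear factors and alternatives passes**: factors = the `fac` entries,
side conditions ⊆ the `vz` entries. [folklore] -/
def lwitForB (p q : ℕ) (G : Terms 4 k) (j i : Fin 4) (lin : List (Fin 4 × k)) (ρ : List (LAlt k)) (w : LWit k) :
    Bool :=
  decide (w.j = j) && decide (w.i = i) && decide (w.lin = lin) && decide (w.facs = facsOf ρ) &&
    (w.zs.all fun zc => decide (zc.1 ∈ vzsOf ρ)) && lwitB p q G w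

/-- Unpacking `lwitForB`. [folklore] -/
theorem lwitForB_spec {p q : ℕ} {G : Terms 4 k} {j i : Fin 4} {lin : List (Fin 4 × k)} {ρ : List (LAlt k)}
    {w : LWit k} (h : lwitForB p q G j i lin ρ w = true) :
    w.j = j ∧ w.i = i ∧ w.lin = lin ∧ w.facs = facsOf ρ ∧ (∀ zc ∈ w.zs, zc.1 ∈ vzsOf ρ) ∧ lwitB p q G w = true := by
  unfold lwitForB at h
  simp only [Bool.and_eq_true, decide_eq_true_eq, List.all_eq_true] at h
  exact ⟨h.1.1.1.1.1, h.1.1.1.1.2, h.1.1.1.2, h.1.1.2, h.1.2, h.2⟩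

/-- **The cover check of chart `j`** (FCert v3). [folklore] -/
def lcoverOKL {C : Type} (p q : ℕ) (s : SData 4 k) (S : Finset (Fin 4)) (j : Fin 4) (wits : List (LWit k))
    (flats : List (Flat k)) (leaves : List (ILeaf k C)) : Bool :=
  decide (∀ i : Fin 4, i ≠ j →
    ∀ τ ∈ ((flats.filter fun φ : Flat k => decide (φ.j = j)).map fixedCoordsL).sections,
      ∀ ρ ∈ ((leaves.filter fun ℓ : ILeaf k C => decide (ℓ.j = j)).map alts).sections,
        ∃ w ∈ wits, lwitForB p q (chartL q S j s.L) j i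
          (List.zipWith (fun (φ : Flat k) (t : Fin 4) => (t, φ.b0 t))
            (flats.filter fun φ : Flat k => decide (φ.j = j)) τ) ρ w = true)

omit [DecidableEq k] in
/-- If `b` is on no leaf of the list, some section of alternatives holds at `b` entrywise. [folklore] -/
theorem exists_section_of_forall_not_onILeaf {C : Type} {K : Type} [Field K] (f : k →+* K) {b : Fin 4 → K} :
    ∀ (leaves : List (ILeaf k C)), (∀ ℓ ∈ leaves, ¬ OnLeaf f ℓ b) →
      ∃ ρ ∈ (leaves.map alts).sections, ∀ t ∈ ρ, AltHolds f b t
  | [], _ => ⟨[], by simp [List.sections], by simp⟩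
  | ℓ :: rest, hnot => by
    classical
    obtain ⟨ρ, hρ, hall⟩ := exists_section_of_forall_not_onILeaf f rest
      (fun ψ hψ => hnot ψ (List.mem_cons_of_mem _ hψ))
    obtain ⟨t, ht, hth⟩ := exists_alt_of_not_onLeaf f ℓ (hnot ℓ List.mem_cons_self)
    refine ⟨t :: ρ, ?_, ?_⟩
    · rw [List.map_cons, List.sections]
      simp only [List.mem_flatMap, List.mem_map]
      exact ⟨ρ, hρ, t, ht, rfl⟩
    · intro t' ht'
      rcases List.mem_cons.mp ht' with rfl | h'
      · exact hth
      · exact hall t' h'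

/-- **THE COVER** (FCert v3): at a chart `j` passing `lcoverOKL`, every equimultiple `K`-point `b` (`b_j = 0`) is
`f ∘ b₀` for a `k`-point `b₀` with `b₀ j = 0`, or lies on a flat of the chart, or lies on a leaf of the chart.
[folklore] -/
theorem rational_or_onFlat_or_onILeaf {C : Type} {p : ℕ} [Fact p.Prime] {q : ℕ} {K : Type} [Field K] [CharP K p]
    [DecidableEq K] (f : ZMod p →+* K) {s : SData 4 (ZMod p)} {S : Finset (Fin 4)} {j : Fin 4}
    {wits : List (LWit (ZMod p))} {flats : List (Flat (ZMod p))} {leaves : List (ILeaf (ZMod p) C)}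
    (hcov : lcoverOKL p q s S j wits flats leaves = true)
    (h0 : ∀ φ ∈ flats, φ.b0 φ.j = 0) {b : Fin 4 → K} (hbj : b j = 0)
    (heq : IsEquimultiplePoint q S j b (⟨MvPolynomial.map f s.toState.F, s.toState.r, s.toState.exc⟩ : State K)) :
    (∃ b₀ : Fin 4 → ZMod p, b₀ j = 0 ∧ f ∘ b₀ = b) ∨ (∃ φ ∈ flats, φ.j = j ∧ OnFlat f φ b) ∨
      ∃ ℓ ∈ leaves, ℓ.j = j ∧ OnLeaf f ℓ b := by
  classical
  by_cases hflat : ∃ φ ∈ flats, φ.j = j ∧ OnFlat f φ b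
  · exact Or.inr (Or.inl hflat)
  by_cases hleaf : ∃ ℓ ∈ leaves, ℓ.j = j ∧ OnLeaf f ℓ b
  · exact Or.inr (Or.inr hleaf)
  left
  push Not at hflat hleaf
  unfold lcoverOKL at hcov
  have hall := of_decide_eq_true hcov
  set fl := flats.filter fun φ : Flat (ZMod p) => decide (φ.j = j) with hfl
  set lv := leaves.filter fun ℓ : ILeaf (ZMod p) C => decide (ℓ.j = j) with hlv
  have hflj : ∀ φ ∈ fl, φ.j = j := fun φ hφ => of_decide_eq_true (List.mem_filter.mp hφ).2
  have hfl0 : ∀ φ ∈ fl, φ.b0 φ.j = 0 := fun φ hφ => h0 φ (List.mem_filter.mp hφ).1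
  have hnotf : ∀ φ ∈ fl, ¬ OnFlat f φ b := fun φ hφ => hflat φ (List.mem_filter.mp hφ).1 (hflj φ hφ)
  have hnotl : ∀ ℓ ∈ lv, ¬ OnLeaf f ℓ b := fun ℓ hℓ =>
    hleaf ℓ (List.mem_filter.mp hℓ).1 (of_decide_eq_true (List.mem_filter.mp hℓ).2)
  obtain ⟨τ, hτ, hprodτ⟩ := exists_sectionL_of_forall_not_onFlat f hbj fl hflj hfl0 hnotf
  obtain ⟨ρ, hρ, hρall⟩ := exists_section_of_forall_not_onILeaf f lv hnotl
  obtain ⟨hprodρ, hvz⟩ := facsOf_prod_ne_zero f b ρ hρall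
  have hcoord : ∀ i : Fin 4, ∃ c : ZMod p, f c = b i := by
    intro i
    by_cases hij : i = j
    · exact ⟨0, by rw [map_zero, hij, hbj]⟩
    · obtain ⟨w, -, hwf⟩ := hall i hij τ hτ ρ hρ
      obtain ⟨hwj, hwi, hwlin, hwfacs, hwzs, hw⟩ := lwitForB_spec hwf
      have hpow := pow_eq_zero_of_lwitB hw f b (by rw [hwj]; exact hbj)
        (fun α hα0 hαq => eval₂Hom_hasseDeriv_eq_zero_of_isEquimultiplePoint f s heq α hα0 hαq)
        (fun zc hzc => hvz zc.1 (hwzs zc hzc))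
      rw [hwi, hwlin, hwfacs] at hpow
      rcases Nat.eq_zero_or_pos w.N with hN | hN
      · rw [hN, pow_zero] at hpow; exact absurd hpow one_ne_zero
      have hmul := (pow_eq_zero_iff hN.ne').mp hpow
      rcases mul_eq_zero.mp hmul with h12 | h3
      · rcases mul_eq_zero.mp h12 with h1 | h2
        · exact exists_eq_cast_of_pow_char_eq f (sub_eq_zero.mp h1)
        · exact absurd h2 hprodτ
      · exact absurd h3 hprodρ
  choose b₀ hb₀ using hcoord
  refine ⟨b₀, ?_, funext fun i => hb₀ i⟩
  have : f (b₀ j) = f 0 := by rw [hb₀ j, hbj, map_zero]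
  exact f.injective this

end WinCertLeaf

end Summit.ResolutionOfSingularities.ResolutionOfSingularities.Theorems.PIDim4

end
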